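import Literature.NumberTheory.Automorphic.FuchsianKloostermanSums
import HarnessLib

/-!
# Kloosterman sums of a cusp pair: the moduli are `≥ 1` and the averaged bounds (2.33), (2.38)
(Iwaniec, *Spectral Methods of Automorphic Forms*, GSM 53, §2.6 Prop. 2.8 (2.33)–(2.36), Cor. 2.9
(2.38), and the remark `c(𝔞,𝔟)² ≥ c_𝔞𝔟`; PDF p. 38)

Topic `Literature/NumberTheory/Automorphic`, namespace `…Automorphic.Fuchsian`; continuation of
`FuchsianKloostermanSums.lean`.  Everything here is PROVED (theorems only).

1. `sum_le_max_sub_min_add` — the gap principle behind (2.33): for finitely many real points with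
   weights `w(p) ≤ |p − q|` for all other points `q`, `∑ w ≤ (max − min) + w(max)` (induction on the
   maximum: "where `d'/c'` is chosen to be the successive point to `d/c`").
2. `one_le_of_mem_kloostermanModuli` — **every modulus is `≥ 1`** after scaling (Iwaniec: "Notice that
   `c(𝔞, 𝔟)² ≥ c_𝔞𝔟`"): `ω⁻¹ T_1 ω ∈ σ_𝔟⁻¹Γσ_𝔟` has lower-left entry `−c²`, and Shimizu's lemma applies.
3. `one_le_abs_sub_frac` — **the spacing (2.34)/(2.36) of the points `d/c` across the moduli**:
   distinct bottom rows `(c, d) ≠ (c', d')` have `|c'd − cd'| ≥ 1`.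
4. `finite_rowsLE`, `sum_inv_le` — the set of pairs `(c, d)`, `c ≤ X`, `d (mod c)` is finite and
   **`∑_{c ≤ X} c⁻¹ S_𝔞𝔟(0, 0; c) ≤ 2X`** (Iwaniec (2.33): `≤ c_𝔞𝔟⁻¹ X`; our constant `2` absorbs the
   last gap), as the bound `∑_{(c,d)} 1/c ≤ 2X` over that set; and **(2.38)**
   `sum_inv_norm_cuspKloosterman_le : ∑_{c ≤ X} c⁻¹ |S_𝔞𝔟(m, n; c)| ≤ 2X` over any finite set of moduli `≤ X`.

## References
* [Iwaniec2002] H. Iwaniec, *Spectral Methods of Automorphic Forms*, 2nd ed., GSM 53, AMS 2002, §2.6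
  Prop. 2.8 (2.32)–(2.36), Cor. 2.9 (2.37)–(2.38), PDF p. 38 (held copy
  `book:iwaniec2002-spectral-methods-automorphic-forms`, page read).
-/

noncomputable section

open Matrix Finset
open scoped MatrixGroups Pointwise FourierTransform

namespace Literature.NumberTheory.Automorphic

namespace Fuchsian

variable {Γ : Subgroup (GL (Fin 2) ℝ)}

/-! ## 1. The gap principle -/

/-- **The gap principle**: if finitely many real points carry weights `w(p)` with `w(p) ≤ |p − q|`
for every other point `q`, then `∑_p w(p) ≤ (max − min) + w(max)` (each weight but the last is at
most the gap to the successor). [cite: Iwaniec2002, §2.6 proof of Prop. 2.8 ("summing … where `d'/c'` is chosen to be the successive point"), PDF p. 38] -/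
theorem sum_le_max_sub_min_add {P : Finset ℝ} (hne : P.Nonempty) {w : ℝ → ℝ}
    (hsep : ∀ p ∈ P, ∀ q ∈ P, p ≠ q → w p ≤ |p - q|) :
    ∑ p ∈ P, w p ≤ (P.max' hne - P.min' hne) + w (P.max' hne) := by
  induction P using Finset.induction_on_max with
  | empty => exact absurd hne Finset.not_nonempty_empty
  | insert a s ha ih =>
    have has : a ∉ s := fun h => lt_irrefl a (ha a h)
    rcases s.eq_empty_or_nonempty with rfl | hs
    · simp
    · have hsep' : ∀ p ∈ s, ∀ q ∈ s, p ≠ q → w p ≤ |p - q| :=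
        fun p hp q hq hpq => hsep p (mem_insert_of_mem hp) q (mem_insert_of_mem hq) hpq
      have ih' := ih hs hsep'
      have hmax_s : s.max' hs < a := ha _ (max'_mem s hs)
      have hmax : (insert a s).max' hne = a := by
        rw [Finset.max'_insert a s hs, max_eq_left hmax_s.le]
      have hmin : (insert a s).min' hne = s.min' hs := by
        rw [Finset.min'_insert a s hs, min_eq_right]
        exact (min'_le s _ (max'_mem s hs)).trans hmax_s.le
      have hw : w (s.max' hs) ≤ a - s.max' hs := by
        have h := hsep (s.max' hs) (mem_insert_of_mem (max'_mem s hs)) a (mem_insert_self a s)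
          hmax_s.ne
        rwa [abs_sub_comm, abs_of_pos (sub_pos.2 hmax_s)] at h
      rw [sum_insert has, hmax, hmin]
      linarith

/-- The gap principle for points given by an injective position map `pos` on a finite set of any
type: `∑_x wt(x) ≤ (sup pos − inf pos) + wt(argmax pos)`, in the form with upper bounds
`pos ∈ [lo, hi]`, `wt ≤ W`: `∑ wt ≤ (hi − lo) + W`. [folklore] -/
theorem sum_le_of_separated_pos {α : Type*} (S : Finset α) (pos wt : α → ℝ)
    (hinj : Set.InjOn pos S) (hsep : ∀ x ∈ S, ∀ y ∈ S, x ≠ y → wt x ≤ |pos x - pos y|)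
    {lo hi W : ℝ} (hlohi : lo ≤ hi) (hW : 0 ≤ W) (hlo : ∀ x ∈ S, lo ≤ pos x) (hhi : ∀ x ∈ S, pos x ≤ hi)
    (hwt : ∀ x ∈ S, wt x ≤ W) :
    ∑ x ∈ S, wt x ≤ (hi - lo) + W := by
  classical
  rcases S.eq_empty_or_nonempty with rfl | hne
  · simp; linarith
  set P : Finset ℝ := S.image pos with hP
  have hPne : P.Nonempty := hne.image _
  have hne' := hne
  obtain ⟨x0, -⟩ := hne'
  haveI : Nonempty α := ⟨x0⟩
  -- the weight as a function of the position
  set w : ℝ → ℝ := fun t => wt (Function.invFunOn pos S t) with hw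
  have hwx : ∀ x ∈ S, w (pos x) = wt x := by
    intro x hx
    have h1 : Function.invFunOn pos S (pos x) = x :=
      hinj (Function.invFunOn_mem ⟨x, hx, rfl⟩) hx (Function.invFunOn_eq ⟨x, hx, rfl⟩)
    simp only [hw, h1]
  have hsum : ∑ x ∈ S, wt x = ∑ t ∈ P, w t := by
    rw [hP, Finset.sum_image fun x hx y hy h => hinj hx hy h]
    exact Finset.sum_congr rfl fun x hx => (hwx x hx).symm
  have hsepP : ∀ p ∈ P, ∀ q ∈ P, p ≠ q → w p ≤ |p - q| := by
    intro p hp q hq hpq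
    obtain ⟨x, hx, rfl⟩ := Finset.mem_image.1 hp
    obtain ⟨y, hy, rfl⟩ := Finset.mem_image.1 hq
    rw [hwx x hx]
    exact hsep x hx y hy fun h => hpq (by rw [h])
  have hgap := sum_le_max_sub_min_add hPne hsepP
  obtain ⟨xM, hxM, hxMe⟩ := Finset.mem_image.1 (max'_mem P hPne)
  obtain ⟨xm, hxm, hxme⟩ := Finset.mem_image.1 (min'_mem P hPne)
  have h1 : P.max' hPne ≤ hi := by rw [← hxMe]; exact hhi xM hxM
  have h2 : lo ≤ P.min' hPne := by rw [← hxme]; exact hlo xm hxm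
  have h3 : w (P.max' hPne) ≤ W := by rw [← hxMe, hwx xM hxM]; exact hwt xM hxM
  rw [hsum]
  linarith

/-! ## 2. The moduli are at least one -/

/-- The lower-left entry of `ω⁻¹ T_1 ω` is `−c²`. [folklore] -/
theorem inv_translSL_mul_apply_10 (ω : SL(2, ℝ)) : (ω⁻¹ * translSL 1 * ω) 1 0 = -(ω 1 0) ^ 2 := by
  simp [Matrix.mul_apply, Fin.sum_univ_two, Matrix.SpecialLinearGroup.coe_inv, Matrix.adjugate_fin_two]
  ring

/-- `ω⁻¹ T_1 ω ∈ σ_𝔟⁻¹Γσ_𝔟` for `ω ∈ σ_𝔞⁻¹Γσ_𝔟` and `T_1 ∈ σ_𝔞⁻¹Γσ_𝔞`. [folklore] -/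
theorem inv_translSL_mul_mem {σa σb ω : SL(2, ℝ)} (hω : ω ∈ cuspPairSet Γ σa σb)
    (hTa : translSL 1 ∈ cuspPairSet Γ σa σa) : ω⁻¹ * translSL 1 * ω ∈ cuspPairSet Γ σb σb := by
  rw [mem_cuspPairSet_iff] at hω hTa ⊢
  have : σb * (ω⁻¹ * translSL 1 * ω) * σb⁻¹ =
      (σa * ω * σb⁻¹)⁻¹ * (σa * translSL 1 * σa⁻¹) * (σa * ω * σb⁻¹) := by group
  rw [this, map_mul, map_mul, map_inv]
  exact Γ.mul_mem (Γ.mul_mem (Γ.inv_mem hω) hTa) hω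

/-- **The moduli are `≥ 1`** (Iwaniec: "`c(𝔞, 𝔟)² ≥ c_𝔞𝔟`", here with `c_𝔞, c_𝔟 ≥ 1` after scaling):
for `Γ ≤ SL₂(ℝ)` discrete with `T_1 ∈ σ_𝔞⁻¹Γσ_𝔞` and `T_1 ∈ σ_𝔟⁻¹Γσ_𝔟`, every `c ∈ 𝒞_𝔞𝔟` satisfies
`c ≥ 1` (Shimizu's lemma for `ω⁻¹T_1ω`, of lower-left entry `−c²`). [cite: Iwaniec2002, §2.6 (after Prop. 2.8), PDF p. 38] -/
theorem one_le_of_mem_kloostermanModuli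
    (hΓ : Γ ≤ (Matrix.SpecialLinearGroup.toGL : SL(2, ℝ) →* GL (Fin 2) ℝ).range)
    (hd : IsDiscreteSubgroup Γ) {σa σb : SL(2, ℝ)} (hTa : translSL 1 ∈ cuspPairSet Γ σa σa)
    (hTb : translSL 1 ∈ cuspPairSet Γ σb σb) {c : ℝ} (hc : c ∈ kloostermanModuli Γ σa σb) : 1 ≤ c := by
  obtain ⟨hc0, ω, hω, rfl⟩ := hc
  set Γb : Subgroup (GL (Fin 2) ℝ) :=
    ConjAct.toConjAct (Matrix.SpecialLinearGroup.toGL σb : GL (Fin 2) ℝ)⁻¹ • Γ with hΓb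
  have hΓb_le : Γb ≤ (Matrix.SpecialLinearGroup.toGL : SL(2, ℝ) →* GL (Fin 2) ℝ).range := by
    have h := conj_le_range hΓ σb⁻¹
    rwa [map_inv] at h
  have hΓb_d : IsDiscreteSubgroup Γb := hd.conj _
  have hT1 : Matrix.GeneralLinearGroup.upperRightHom (1 : ℝ) ∈ Γb := by
    rw [← toGL_translSL]; exact toGL_mem_conj_iff_mem_cuspPairSet.2 hTb
  have hmem : (Matrix.SpecialLinearGroup.toGL (ω⁻¹ * translSL 1 * ω) : GL (Fin 2) ℝ) ∈ Γb :=
    toGL_mem_conj_iff_mem_cuspPairSet.2 (inv_translSL_mul_mem hω hTa)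
  have e : ∀ (h : SL(2, ℝ)) i j,
      ((Matrix.SpecialLinearGroup.toGL h : GL (Fin 2) ℝ) : Matrix (Fin 2) (Fin 2) ℝ) i j = h i j :=
    fun h i j => rfl
  have hne0 : (Matrix.SpecialLinearGroup.toGL (ω⁻¹ * translSL 1 * ω) : GL (Fin 2) ℝ) 1 0 ≠ 0 := by
    show ((Matrix.SpecialLinearGroup.toGL (ω⁻¹ * translSL 1 * ω) : GL (Fin 2) ℝ) :
      Matrix (Fin 2) (Fin 2) ℝ) 1 0 ≠ 0
    rw [e, inv_translSL_mul_apply_10]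
    exact neg_ne_zero.2 (pow_ne_zero 2 hc0.ne')
  have h := one_le_abs_mul_of_mem hΓb_le hΓb_d one_pos hT1 hmem hne0
  rw [mul_one] at h
  have h2 : |((Matrix.SpecialLinearGroup.toGL (ω⁻¹ * translSL 1 * ω) : GL (Fin 2) ℝ) :
      Matrix (Fin 2) (Fin 2) ℝ) 1 0| = (ω 1 0) ^ 2 := by
    rw [e, inv_translSL_mul_apply_10, abs_neg, abs_of_nonneg (sq_nonneg _)]
  rw [h2] at h
  nlinarith [hc0]

/-! ## 3. Spacing of the fractions `d/c` across the moduli -/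

/-- **Spacing across moduli** (Iwaniec (2.34), (2.36) with `c_𝔞 ≥ 1`): two different bottom rows
`(c, d) ≠ (c', d')` of `σ_𝔞⁻¹Γσ_𝔟` with `c, c' > 0` satisfy `|c'd − cd'| ≥ 1` (`c'd − cd'` is the
lower-left entry of `ω'ω⁻¹ ∈ σ_𝔞⁻¹Γσ_𝔞`; if it vanished, `ω' = ±T_xω` would force `(c', d') = (c, d)`).
[cite: Iwaniec2002, §2.6 proof of Prop. 2.8 (2.34), PDF p. 38] -/
theorem one_le_abs_sub_frac
    (hΓ : Γ ≤ (Matrix.SpecialLinearGroup.toGL : SL(2, ℝ) →* GL (Fin 2) ℝ).range)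
    (hd : IsDiscreteSubgroup Γ) {σa σb : SL(2, ℝ)} (hTa : translSL 1 ∈ cuspPairSet Γ σa σa)
    {c c' d d' : ℝ} (hc : 0 < c) (hc' : 0 < c') (hdD : d ∈ bottomEntries Γ σa σb c)
    (hdD' : d' ∈ bottomEntries Γ σa σb c') (hne : (c, d) ≠ (c', d')) : 1 ≤ |c' * d - c * d'| := by
  obtain ⟨ω, hω, rfl, rfl⟩ := hdD
  obtain ⟨ω', hω', rfl, rfl⟩ := hdD'
  set Γa : Subgroup (GL (Fin 2) ℝ) :=
    ConjAct.toConjAct (Matrix.SpecialLinearGroup.toGL σa : GL (Fin 2) ℝ)⁻¹ • Γ with hΓa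
  have hΓa_le : Γa ≤ (Matrix.SpecialLinearGroup.toGL : SL(2, ℝ) →* GL (Fin 2) ℝ).range := by
    have h := conj_le_range hΓ σa⁻¹
    rwa [map_inv] at h
  have hΓa_d : IsDiscreteSubgroup Γa := hd.conj _
  have hT1 : Matrix.GeneralLinearGroup.upperRightHom (1 : ℝ) ∈ Γa := by
    rw [← toGL_translSL]; exact toGL_mem_conj_iff_mem_cuspPairSet.2 hTa
  have hinf : IsCusp OnePoint.infty Γa := isCusp_infty_of_mem hT1
  have hmem : (Matrix.SpecialLinearGroup.toGL (ω' * ω⁻¹) : GL (Fin 2) ℝ) ∈ Γa :=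
    toGL_mem_conj_iff_mem_cuspPairSet.2 (mul_inv_mem_cuspPairSet hω hω')
  have hentry : (ω' * ω⁻¹) 1 0 = ω' 1 0 * ω 1 1 - ω 1 0 * ω' 1 1 := mul_inv_apply_10 ω ω'
  have e : ∀ (h : SL(2, ℝ)) i j,
      ((Matrix.SpecialLinearGroup.toGL h : GL (Fin 2) ℝ) : Matrix (Fin 2) (Fin 2) ℝ) i j = h i j :=
    fun h i j => rfl
  by_cases h0 : (ω' * ω⁻¹) 1 0 = 0
  · -- then `ω' = ± T_x ω`, contradicting `(c, d) ≠ (c', d')`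
    exfalso
    have h0' : (Matrix.SpecialLinearGroup.toGL (ω' * ω⁻¹) : GL (Fin 2) ℝ) 1 0 = 0 := by
      show ((Matrix.SpecialLinearGroup.toGL (ω' * ω⁻¹) : GL (Fin 2) ℝ) : Matrix (Fin 2) (Fin 2) ℝ) 1 0 = 0
      rw [e]; exact h0
    obtain ⟨x, hx | hx⟩ := eq_upperRightHom_or_neg_of_upperTriangular hΓa_le hΓa_d hinf hmem h0'
    · have h1 : Matrix.SpecialLinearGroup.toGL (ω' * ω⁻¹) =
          Matrix.SpecialLinearGroup.toGL (translSL x) := by rw [hx, toGL_translSL]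
      have h2 := Matrix.SpecialLinearGroup.toGL_injective h1
      have h3 : ω' = translSL x * ω := by rw [← h2, inv_mul_cancel_right]
      obtain ⟨-, -, h10, h11⟩ := translSL_mul_apply x ω
      apply hne
      rw [h3, h10, h11]
    · have h1 : Matrix.SpecialLinearGroup.toGL (ω' * ω⁻¹) =
          Matrix.SpecialLinearGroup.toGL (-translSL x) := by rw [hx, toGL_neg, toGL_translSL]
      have h2 := Matrix.SpecialLinearGroup.toGL_injective h1
      have h3 : ω' = -(translSL x * ω) := by rw [← neg_mul, ← h2, inv_mul_cancel_right]
      have h4 : ω' 1 0 = -(ω 1 0) := by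
        rw [h3, Matrix.SpecialLinearGroup.coe_neg, Matrix.neg_apply, (translSL_mul_apply x ω).2.2.1]
      linarith
  · have h := one_le_abs_mul_of_mem hΓa_le hΓa_d one_pos hT1 hmem (by
      show ((Matrix.SpecialLinearGroup.toGL (ω' * ω⁻¹) : GL (Fin 2) ℝ) : Matrix (Fin 2) (Fin 2) ℝ) 1 0 ≠ 0
      rw [e]; exact h0)
    rw [mul_one] at h
    have : |((Matrix.SpecialLinearGroup.toGL (ω' * ω⁻¹) : GL (Fin 2) ℝ) : Matrix (Fin 2) (Fin 2) ℝ) 1 0| =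
        |ω' 1 0 * ω 1 1 - ω 1 0 * ω' 1 1| := by rw [e, hentry]
    rwa [this] at h

/-! ## 4. Finiteness of the rows of bounded modulus and the averaged bounds (2.33), (2.38) -/

variable (Γ)

/-- The pairs `(c, d)`: `c ∈ 𝒞_𝔞𝔟`, `c ≤ X`, `d` a representative `(mod c)` in `[0, c)`. [folklore] -/
def rowsLE (σa σb : SL(2, ℝ)) (X : ℝ) : Set (ℝ × ℝ) :=
  {p | p.1 ∈ kloostermanModuli Γ σa σb ∧ p.1 ≤ X ∧ p.2 ∈ bottomReps Γ σa σb p.1}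

variable {Γ}

/-- The points `d/c` of the rows of modulus `≤ X` lie in `[0, 1)` and are `X⁻²`-separated; the map
`(c, d) ↦ d/c` is injective on them. [cite: Iwaniec2002, §2.6 (2.36), PDF p. 38] -/
theorem frac_sep_of_mem_rowsLE
    (hΓ : Γ ≤ (Matrix.SpecialLinearGroup.toGL : SL(2, ℝ) →* GL (Fin 2) ℝ).range)
    (hd : IsDiscreteSubgroup Γ) {σa σb : SL(2, ℝ)} (hTa : translSL 1 ∈ cuspPairSet Γ σa σa)
    {X : ℝ} {p q : ℝ × ℝ} (hp : p ∈ rowsLE Γ σa σb X) (hq : q ∈ rowsLE Γ σa σb X) (hne : p ≠ q) :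
    1 / (p.1 * q.1) ≤ |p.2 / p.1 - q.2 / q.1| := by
  obtain ⟨⟨hc, -⟩, -, hdp, -⟩ := hp
  obtain ⟨⟨hc', -⟩, -, hdq, -⟩ := hq
  have h1 := one_le_abs_sub_frac hΓ hd hTa hc hc' hdp hdq (by
    intro h; exact hne (Prod.ext (congrArg Prod.fst h) (congrArg Prod.snd h)))
  have hcc : 0 < p.1 * q.1 := mul_pos hc hc'
  rw [div_le_iff₀ hcc]
  have : |p.2 / p.1 - q.2 / q.1| * (p.1 * q.1) = |q.1 * p.2 - p.1 * q.2| := by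
    rw [← abs_of_pos hcc, ← abs_mul]
    congr 1
    field_simp
  rw [this]
  exact h1

/-- **Finiteness of the rows of modulus `≤ X`** (at most `X² + 1` of them). [cite: Iwaniec2002, §2.6 Prop. 2.8, PDF p. 38] -/
theorem finite_rowsLE
    (hΓ : Γ ≤ (Matrix.SpecialLinearGroup.toGL : SL(2, ℝ) →* GL (Fin 2) ℝ).range)
    (hd : IsDiscreteSubgroup Γ) {σa σb : SL(2, ℝ)} (hTa : translSL 1 ∈ cuspPairSet Γ σa σa)
    {X : ℝ} (hX : 0 < X) : (rowsLE Γ σa σb X).Finite := by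
  classical
  -- the map `(c, d) ↦ d/c` is injective on `rowsLE`, with an `X⁻²`-separated image in `[0, 1)`
  have hinj : Set.InjOn (fun p : ℝ × ℝ => p.2 / p.1) (rowsLE Γ σa σb X) := by
    intro p hp q hq hpq
    by_contra hne
    have h := frac_sep_of_mem_rowsLE hΓ hd hTa hp hq hne
    simp only at hpq
    rw [hpq, sub_self, abs_zero] at h
    have : 0 < 1 / (p.1 * q.1) := by
      have := hp.1.1; have := hq.1.1; positivity
    linarith
  refine Set.Finite.of_finite_image ?_ hinj
  by_contra hinf
  obtain ⟨T, hT, hcard⟩ := Set.Infinite.exists_subset_card_eq hinf (⌊X ^ 2⌋₊ + 2)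
  have hsep : ∀ a ∈ T, ∀ b ∈ T, a ≠ b → 1 / X ^ 2 ≤ |a - b| := by
    intro a ha b hb hab
    obtain ⟨p, hp, rfl⟩ := hT ha
    obtain ⟨q, hq, rfl⟩ := hT hb
    have hne : p ≠ q := fun h => hab (by rw [h])
    refine le_trans ?_ (frac_sep_of_mem_rowsLE hΓ hd hTa hp hq hne)
    have h1 : p.1 * q.1 ≤ X ^ 2 := by
      have := hp.1.1; have := hq.1.1
      calc p.1 * q.1 ≤ X * X := mul_le_mul hp.2.1 hq.2.1 hq.1.1.le hX.le
        _ = X ^ 2 := (sq X).symm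
    have h2 : 0 < p.1 * q.1 := mul_pos hp.1.1 hq.1.1
    exact one_div_le_one_div_of_le h2 h1
  have hdiam : ∀ a ∈ T, ∀ b ∈ T, a - b ≤ 1 := by
    intro a ha b hb
    obtain ⟨p, hp, rfl⟩ := hT ha
    obtain ⟨q, hq, rfl⟩ := hT hb
    have hp1 : p.2 / p.1 < 1 := by
      rw [div_lt_one hp.1.1]; exact hp.2.2.2.2
    have hq0 : 0 ≤ q.2 / q.1 := div_nonneg hq.2.2.2.1 hq.1.1.le
    simp only
    linarith
  have h := card_le_of_separated (by positivity) zero_le_one hsep hdiam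
  rw [hcard] at h
  push_cast at h
  have h2 : (1 : ℝ) / (1 / X ^ 2) = X ^ 2 := by field_simp
  rw [h2] at h
  have := Nat.lt_floor_add_one (X ^ 2)
  linarith

/-- **The weighted count of the rows of modulus `≤ X`: `∑_{(c,d)} 1/c ≤ 2X`** (Iwaniec (2.33):
`∑_{c ≤ X} c⁻¹ S_𝔞𝔟(0,0;c) ≤ c_𝔞𝔟⁻¹ X`; here `c_𝔞, c_𝔟 ≥ 1` after scaling and the constant `2` absorbs
the last gap), by the gap principle for the points `d/c ∈ [0, 1)` with weights `1/(cX)`, for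
`Γ ≤ SL₂(ℝ)` discrete, `T_1 ∈ σ_𝔞⁻¹Γσ_𝔞`, `T_1 ∈ σ_𝔟⁻¹Γσ_𝔟`, `X ≥ 1`.
[cite: Iwaniec2002, §2.6 Prop. 2.8 (2.33), PDF p. 38] -/
theorem sum_inv_le
    (hΓ : Γ ≤ (Matrix.SpecialLinearGroup.toGL : SL(2, ℝ) →* GL (Fin 2) ℝ).range)
    (hd : IsDiscreteSubgroup Γ) {σa σb : SL(2, ℝ)} (hTa : translSL 1 ∈ cuspPairSet Γ σa σa)
    (hTb : translSL 1 ∈ cuspPairSet Γ σb σb) {X : ℝ} (hX : 1 ≤ X) {T : Finset (ℝ × ℝ)}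
    (hT : (T : Set (ℝ × ℝ)) ⊆ rowsLE Γ σa σb X) : ∑ p ∈ T, 1 / p.1 ≤ 2 * X := by
  classical
  have hX0 : 0 < X := by linarith
  have key : ∑ p ∈ T, 1 / (p.1 * X) ≤ (1 - 0) + 1 := by
    refine sum_le_of_separated_pos T (fun p => p.2 / p.1) (fun p => 1 / (p.1 * X)) ?_ ?_ zero_le_one
      zero_le_one ?_ ?_ ?_
    · intro p hp q hq hpq
      by_contra hne
      have h := frac_sep_of_mem_rowsLE hΓ hd hTa (hT hp) (hT hq) hne
      simp only at hpq
      rw [hpq, sub_self, abs_zero] at h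
      have : 0 < 1 / (p.1 * q.1) := by
        have := (hT hp).1.1; have := (hT hq).1.1; positivity
      linarith
    · intro p hp q hq hpq
      refine le_trans ?_ (frac_sep_of_mem_rowsLE hΓ hd hTa (hT hp) (hT hq) hpq)
      have hp1 := (hT hp).1.1
      have hq1 := (hT hq).1.1
      exact one_div_le_one_div_of_le (mul_pos hp1 hq1) (mul_le_mul_of_nonneg_left (hT hq).2.1 hp1.le)
    · intro p hp
      exact div_nonneg (hT hp).2.2.2.1 (hT hp).1.1.le
    · intro p hp
      exact (div_lt_one (hT hp).1.1).2 (hT hp).2.2.2.2 |>.le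
    · intro p hp
      have hc1 : 1 ≤ p.1 := one_le_of_mem_kloostermanModuli hΓ hd hTa hTb (hT hp).1
      rw [div_le_one (by have := (hT hp).1.1; positivity)]
      nlinarith
  have hscale : ∑ p ∈ T, 1 / p.1 = X * ∑ p ∈ T, 1 / (p.1 * X) := by
    rw [Finset.mul_sum]
    refine Finset.sum_congr rfl fun p hp => ?_
    have := (hT hp).1.1
    field_simp
  rw [hscale]
  nlinarith

/-- **Corollary 2.9 (2.38) on average**: for any finite set `F` of moduli `c ≤ X` (`X ≥ 1`),
`∑_{c ∈ F} c⁻¹ |S_𝔞𝔟(m, n; c)| ≤ 2X` (each `|S_𝔞𝔟(m,n;c)| ≤ S_𝔞𝔟(0,0;c) = #{d (mod c)}`, and (2.33)).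
[cite: Iwaniec2002, §2.6 Cor. 2.9 (2.38), PDF p. 38] -/
theorem sum_inv_norm_cuspKloosterman_le
    (hΓ : Γ ≤ (Matrix.SpecialLinearGroup.toGL : SL(2, ℝ) →* GL (Fin 2) ℝ).range)
    (hd : IsDiscreteSubgroup Γ) {σa σb : SL(2, ℝ)} (hTa : translSL 1 ∈ cuspPairSet Γ σa σa)
    (hTb : translSL 1 ∈ cuspPairSet Γ σb σb) {X : ℝ} (hX : 1 ≤ X) {F : Finset ℝ}
    (hF : ∀ c ∈ F, c ∈ kloostermanModuli Γ σa σb ∧ c ≤ X) (m n : ℤ) :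
    ∑ c ∈ F, ‖cuspKloosterman Γ σa σb m n c‖ / c ≤ 2 * X := by
  classical
  have hX0 : 0 < X := by linarith
  have hfin : ∀ c ∈ F, (bottomReps Γ σa σb c).Finite := fun c hc =>
    finite_bottomReps hΓ hd hTa (hF c hc).1.1
  -- the finite set of rows `(c, d)`, `c ∈ F`, `d (mod c)`
  set S : Set (ℝ × ℝ) := {p | p.1 ∈ F ∧ p.2 ∈ bottomReps Γ σa σb p.1} with hS
  have hSsub : S ⊆ rowsLE Γ σa σb X := fun p hp => ⟨(hF p.1 hp.1).1, (hF p.1 hp.1).2, hp.2⟩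
  have hSfin : S.Finite := (finite_rowsLE hΓ hd hTa hX0).subset hSsub
  set T : Finset (ℝ × ℝ) := hSfin.toFinset with hT
  have hTsub : (T : Set (ℝ × ℝ)) ⊆ rowsLE Γ σa σb X := by
    rw [hT, Set.Finite.coe_toFinset]; exact hSsub
  have hsum := sum_inv_le hΓ hd hTa hTb hX hTsub
  -- group the rows by their modulus
  have hmaps : ∀ p ∈ T, p.1 ∈ F := fun p hp => ((Set.Finite.mem_toFinset hSfin).1 hp).1
  have hgroup : ∑ p ∈ T, 1 / p.1 = ∑ c ∈ F, ∑ p ∈ T.filter (fun p => p.1 = c), 1 / p.1 :=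
    (Finset.sum_fiberwise_of_maps_to hmaps _).symm
  have hfiber : ∀ c (hc : c ∈ F), T.filter (fun p => p.1 = c) = (hfin c hc).toFinset.image (fun d => (c, d)) := by
    intro c hc
    ext p
    rw [Finset.mem_filter, Set.Finite.mem_toFinset, Finset.mem_image]
    constructor
    · rintro ⟨⟨-, hp2⟩, rfl⟩
      exact ⟨p.2, (Set.Finite.mem_toFinset _).2 hp2, rfl⟩
    · rintro ⟨d, hd', rfl⟩
      exact ⟨⟨hc, (Set.Finite.mem_toFinset _).1 hd'⟩, rfl⟩
  have hcount : ∀ c ∈ F, ∑ p ∈ T.filter (fun p => p.1 = c), 1 / p.1 =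
      (cuspKloostermanCount Γ σa σb c : ℝ) * (1 / c) := by
    intro c hc
    rw [hfiber c hc, Finset.sum_image (fun d _ d' _ h => (Prod.ext_iff.1 h).2)]
    simp only [Finset.sum_const, nsmul_eq_mul]
    rw [cuspKloostermanCount, Set.ncard_eq_toFinset_card _ (hfin c hc)]
  calc ∑ c ∈ F, ‖cuspKloosterman Γ σa σb m n c‖ / c
      ≤ ∑ c ∈ F, (cuspKloostermanCount Γ σa σb c : ℝ) * (1 / c) := by
        refine Finset.sum_le_sum fun c hc => ?_
        rw [div_eq_mul_one_div]
        exact mul_le_mul_of_nonneg_right (norm_cuspKloosterman_le_count (hfin c hc) m n)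
          (by have := (hF c hc).1.1; positivity)
    _ = ∑ p ∈ T, 1 / p.1 := by
        rw [hgroup]
        exact (Finset.sum_congr rfl hcount).symm
    _ ≤ 2 * X := hsum

end Fuchsian

end Literature.NumberTheory.Automorphic
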